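import Summits.Ventures.PercRepro.RankLevelSetRuleQStaircase
import Summits.Ventures.PercRepro.RankLevelSetRuleQCellSixSevenWitness
import Summits.Ventures.PercRepro.RankLevelSetRuleQSliceFourWitness
import Summits.Ventures.PercRepro.RankLevelSetRuleQNoFiveUpModel

/-!
# PercRepro — THE EXACT THIN-SLICE MAPS OF THE FAMILIES `k = 6, 7` UP TO `u = 9` (night-1, gen 18; dossier §29.8)

With the staircase (`rhat_staircase`), the borderline slices (`rhat_six_slice_four_all`, `rhat_seven_slice_five_all`), the ends
(`rhatCell_self` / `rhatCell_pred`) and the kernel negatives — the slice `u = 2` for every `k ≥ 5` (`rhat_lt_phiK_of_five_le`),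
p4's witnesses `rhat_lt_phiK_264_6_261` (`u = 3` at `k = 6`), `rhat_lt_phiK_141_7_138` (`u = 3` at `k = 7`) and
`rhat_lt_phiK_304_7_300` (`u = 4` at `k = 7`) — the thin-slice maps are EXACT:
* **`rhat_six_slice_iff`** — a slice `u ≤ 9` of the family `k = 6` is paid on every cell `(q+6, q)` iff `u ∉ {2, 3}`;
* **`rhat_seven_slice_iff`** — a slice `u ≤ 9` of the family `k = 7` is paid on every cell `(q+7, q)` iff `u ∉ {2, 3, 4}`.
(For `k = 5`: `rhat_five_slice_iff`, iff `u ≠ 2`.) Axioms: standard.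
-/

namespace PercRepro

open Finset

/-- **The slices `u ≤ 9` of the family `k = 6`, exactly**: paid on EVERY cell `(q+6, q)` iff `u ∉ {2, 3}`. -/
theorem rhat_six_slice_iff (u : ℕ) (hu9 : u ≤ 9) :
    (∀ q, u ≤ q → phiK (q + 6) q ≤ rhat q 6 (q - u)) ↔ (u ≠ 2 ∧ u ≠ 3) := by
  constructor
  · intro h
    refine ⟨fun hu2 => ?_, fun hu3 => ?_⟩
    · subst hu2
      have h1 := h (4 ^ (6 + 3) + 2) (by norm_num)
      have h2 := rhat_lt_phiK_of_five_le 6 (by norm_num) (4 ^ (6 + 3)) le_rfl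
      rw [show 4 ^ (6 + 3) + 2 - 2 = 4 ^ (6 + 3) by omega] at h1
      exact absurd (lt_of_lt_of_le h2 h1) (lt_irrefl _)
    · subst hu3
      have h1 := h 264 (by norm_num)
      have h2 := rhat_lt_phiK_264_6_261
      rw [show (264 : ℕ) - 3 = 261 by norm_num] at h1
      exact absurd (lt_of_lt_of_le h2 h1) (lt_irrefl _)
  · rintro ⟨hu2, hu3⟩ q hq
    rcases Nat.lt_or_ge u 5 with hlt | hge
    · interval_cases u
      · rw [Nat.sub_zero]; exact rhatCell_self q 6 (by norm_num)
      · exact rhatCell_pred q 6 hq (by norm_num)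
      · exact absurd rfl hu2
      · exact absurd rfl hu3
      · exact rhat_six_slice_four_all q hq
    · exact rhat_staircase 6 u q (by norm_num) (by norm_num) (by omega) hu9 hq

/-- **The slices `u ≤ 9` of the family `k = 7`, exactly**: paid on EVERY cell `(q+7, q)` iff `u ∉ {2, 3, 4}`. -/
theorem rhat_seven_slice_iff (u : ℕ) (hu9 : u ≤ 9) :
    (∀ q, u ≤ q → phiK (q + 7) q ≤ rhat q 7 (q - u)) ↔ (u ≠ 2 ∧ u ≠ 3 ∧ u ≠ 4) := by
  constructor
  · intro h
    refine ⟨fun hu2 => ?_, fun hu3 => ?_, fun hu4 => ?_⟩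
    · subst hu2
      have h1 := h (4 ^ (7 + 3) + 2) (by norm_num)
      have h2 := rhat_lt_phiK_of_five_le 7 (by norm_num) (4 ^ (7 + 3)) le_rfl
      rw [show 4 ^ (7 + 3) + 2 - 2 = 4 ^ (7 + 3) by omega] at h1
      exact absurd (lt_of_lt_of_le h2 h1) (lt_irrefl _)
    · subst hu3
      have h1 := h 141 (by norm_num)
      have h2 := rhat_lt_phiK_141_7_138
      rw [show (141 : ℕ) - 3 = 138 by norm_num] at h1
      exact absurd (lt_of_lt_of_le h2 h1) (lt_irrefl _)
    · subst hu4
      have h1 := h 304 (by norm_num)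
      have h2 := rhat_lt_phiK_304_7_300
      rw [show (304 : ℕ) - 4 = 300 by norm_num] at h1
      exact absurd (lt_of_lt_of_le h2 h1) (lt_irrefl _)
  · rintro ⟨hu2, hu3, hu4⟩ q hq
    rcases Nat.lt_or_ge u 6 with hlt | hge
    · interval_cases u
      · rw [Nat.sub_zero]; exact rhatCell_self q 7 (by norm_num)
      · exact rhatCell_pred q 7 hq (by norm_num)
      · exact absurd rfl hu2
      · exact absurd rfl hu3
      · exact absurd rfl hu4
      · exact rhat_seven_slice_five_all q hq
    · exact rhat_staircase 7 u q (by norm_num) (by norm_num) (by omega) hu9 hq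

end PercRepro
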